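import Summits.ResolutionOfSingularities.ResolutionOfSingularities.Theorems.PurelyInseparableDim4ChartTransfer
import Literature.AlgebraicGeometry.Hironaka2017.Lib.AffineCoordBlowupLSB
import Literature.AlgebraicGeometry.Hironaka2017.Lib.SpecOrders
import Literature.AlgebraicGeometry.Resolution.StrictNormalCrossingsFromRegularSequences
import Literature.AlgebraicGeometry.Resolution.CanonicalResolutionSmoothCentre
import Literature.AlgebraicGeometry.Resolution.MarkedIdealsRestrict
import Literature.RingTheory.MvPolynomial.VariableIdeals
import HarnessLib

/-!
# Coordinate hyperplanes and a coordinate centre of `𝔸ⁿ⁺¹_K` have simple normal crossings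
# (BGMW Def. 3.1.1 / 3.1.3 (2)) — brick TY-2 (c3′) of cell `res-dim4-pi`

[OURS · counted 0] (D-0157 DOOR 2; director-resolution DR-157-C; desk WORD #29 (h) «typ-2 (c3′) ✓»).
For the later moves of the cell's coordinate-centre walk the centre `V(xᵢ : i ∈ Λ)` is blown up in the
presence of a BOUNDARY of exceptional hyperplanes `V(xᵢ)`, `i ∈ T` (read in a chart `≅ 𝔸⁵`,
`PurelyInseparableDim4ChartBoundary.lean`); BGMW's admissibility (Def. 3.1.3 (2), the tree's
`HasSNCWith E C`: at EVERY scheme point a regular system of parameters adapted to all divisors of `E`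
through the point and to `C`) is then the following fact about affine space, PROVED here for every
`n`, every field `K`, every list `l` of coordinates and every set `Λ` of coordinates
(no `sorry`, no new axiom):

* **`hasSNCWith_coordHyperplanes_𝓘Λ`** — `HasSNCWith (l.map fun i => xᵢ·𝒪) (AffineCoordBlowup.𝓘Λ n K Λ)`:
  the coordinate hyperplanes `V(xᵢ)`, `i ∈ l`, have simple normal crossings and the coordinate subspace
  `V(xᵢ : i ∈ Λ)` has simple normal crossings with them; `hasSNC_coordHyperplanes` (`Λ` absent).

Route: the tree's fibre-side criterion `hasSNCWith_of_nonZeroDivisor_data`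
(`StrictNormalCrossingsFromRegularSequences.lean`: principal stalks, regular quotients, non-zero-divisors —
no dimension counts) fed with: the stalk of `𝓘_{V(x_I)}` at `𝔓` is `(xᵢ : i ∈ I)·𝒪_𝔓`
(`stalkIdeal_𝓘Λ`, via HIRONAKA-L `SpecOrders.stalkIdeal_shf`); `𝒪_𝔓/(x_I)` is a regular local ring for
`x_I ⊆ 𝔓` (`AffineCoordBlowupLSB.isRegular_CΛ` + `isRegularLocalRing_stalk_quotient_stalkIdeal`), hence a
domain, in which `xᵢ`, `i ∉ I`, is non-zero (`(x_I)·𝒪_𝔓 ∩ K[x] = (x_I)`,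
`IsLocalization.under_map_of_isPrime_disjoint`; `X_mem_span_X_image_iff`). Nothing here is a statement
about resolution of singularities in dimension ≥ 4 / characteristic `p` (NOT proved anywhere in this
programme). bears_on: LADDER-RESOLUTION:D157-DOOR2 (res-dim4-pi). Supports
stmt-ResolutionOfSingularities-16155 (helper, TY-2 (c3′)).
-/

-- every declaration of this summit lives under `Summit.ResolutionOfSingularities.ResolutionOfSingularities`
-- (summit = problem), which the duplicate-namespace linter flags; house convention (cf. the Target file).
set_option linter.dupNamespace false

noncomputable section

open MvPolynomial CategoryTheory AlgebraicGeometry Opposite TopologicalSpace IsLocalRing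
open AlgebraicGeometry.Scheme.IdealSheafData (ofIdealTop)

namespace Summit.ResolutionOfSingularities.ResolutionOfSingularities.Theorems.PIDim4

open Literature.AlgebraicGeometry.Resolution
open Literature.AlgebraicGeometry.Resolution.AffinePointBlowup (P A γ coord Wtop ξ)
open Literature.AlgebraicGeometry.Hironaka2017.SpecOrders
open Literature.AlgebraicGeometry.Hironaka2017.Lib

namespace ChartDictionary

section CoordinateSNC

variable {n : ℕ} {K : Type} [Field K]

/-! ## §1 Stalks of the ideal sheaves of coordinate subspaces -/

/-- The ideal sheaf of `V(xᵢ : i ∈ I)` is `shf ((Xᵢ : i ∈ I))` of the HIRONAKA-L library. -/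
theorem 𝓘Λ_eq_shf (I : Set (Fin (n + 1))) :
    AffineCoordBlowup.𝓘Λ n K I = shf (A n K) (Ideal.span (X '' I)) := by
  rw [𝓘Λ_eq_ofIdealTop, shf, Ideal.map_span, Set.image_image]
  rfl

/-- **Stalks**: `(𝓘_{V(x_I)})_𝔓 = (Xᵢ : i ∈ I)·𝒪_𝔓`. -/
theorem stalkIdeal_𝓘Λ (I : Set (Fin (n + 1))) (x : P n K) :
    stalkIdeal (AffineCoordBlowup.𝓘Λ n K I) x =
      (Ideal.span (X '' I)).map (algebraMap (A n K) ((P n K).presheaf.stalk x)) := by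
  rw [𝓘Λ_eq_shf]
  exact stalkIdeal_shf (A n K) _ x

/-- The hyperplane sheaf `xᵢ·𝒪` is the ideal sheaf of the coordinate subspace `V(xᵢ)`. -/
theorem ofIdealTop_span_coord_eq_𝓘Λ (i : Fin (n + 1)) :
    ofIdealTop (Ideal.span {coord n K i}) = AffineCoordBlowup.𝓘Λ n K {i} := by
  rw [𝓘Λ_eq_ofIdealTop, Set.image_singleton]

/-- Its stalk: `(xᵢ·𝒪)_𝔓 = xᵢ·𝒪_𝔓`. -/
theorem stalkIdeal_ofIdealTop_span_coord (i : Fin (n + 1)) (x : P n K) :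
    stalkIdeal (ofIdealTop (Ideal.span {coord n K i})) x =
      Ideal.span {algebraMap (A n K) ((P n K).presheaf.stalk x) (X i)} := by
  rw [ofIdealTop_span_coord_eq_𝓘Λ, stalkIdeal_𝓘Λ, Set.image_singleton, Ideal.map_span,
    Set.image_singleton]

/-- Points of `V(x_I)`: `𝔓 ∈ supp 𝓘_{V(x_I)} ↔ Xᵢ ∈ 𝔓` for all `i ∈ I`. -/
theorem mem_support_𝓘Λ_iff (I : Set (Fin (n + 1))) (x : P n K) :
    x ∈ (AffineCoordBlowup.𝓘Λ n K I).support ↔ ∀ i ∈ I, (X i : A n K) ∈ x.asIdeal := by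
  rw [AffineCoordBlowup.support_𝓘Λ]
  exact AffineCoordBlowup.mem_CΛ_iff' n K I x

/-- A point of the hyperplane `V(xᵢ)`: `Xᵢ ∈ 𝔓`. -/
theorem X_mem_asIdeal_of_mem_support {i : Fin (n + 1)} {x : P n K}
    (hx : x ∈ (ofIdealTop (Ideal.span {coord n K i})).support) : (X i : A n K) ∈ x.asIdeal := by
  rw [ofIdealTop_span_coord_eq_𝓘Λ, mem_support_𝓘Λ_iff] at hx
  exact hx i rfl

/-- Distinct coordinates give distinct hyperplane sheaves. -/
theorem ofIdealTop_span_coord_injective :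
    Function.Injective fun i : Fin (n + 1) => ofIdealTop (Ideal.span {coord n K i}) := by
  intro i j h
  -- test at the generic point of `V(xᵢ)`: the prime `(Xᵢ)`
  let x : P n K := ⟨Ideal.span (X '' ({i} : Set (Fin (n + 1)))),
    Literature.RingTheory.MvPolynomial.isPrime_span_X_image _⟩
  have hxi : x ∈ (ofIdealTop (Ideal.span {coord n K i})).support := by
    rw [ofIdealTop_span_coord_eq_𝓘Λ, mem_support_𝓘Λ_iff]
    intro i' hi'
    rw [Set.mem_singleton_iff.mp hi']
    exact Ideal.subset_span ⟨i, rfl, rfl⟩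
  have hxj : x ∈ (ofIdealTop (Ideal.span {coord n K j})).support := by
    have h' := congrFun (congrArg (fun D : (P n K).IdealSheafData => (D.support : Set (P n K))) h) x
    exact (iff_of_eq h').mp hxi
  have hXj := X_mem_asIdeal_of_mem_support hxj
  exact ((Literature.RingTheory.MvPolynomial.X_mem_span_X_image_iff).mp hXj).symm

/-! ## §2 Regular quotients and non-zero-divisors at a point of `V(x_I)` -/

/-- **`𝒪_𝔓/(x_I)` is a regular local ring** for `x_I ⊆ 𝔓` (the coordinate subspace `V(x_I)` is a
regular scheme, HIRONAKA-L `AffineCoordBlowupLSB.isRegular_CΛ`). -/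
theorem isRegularLocalRing_stalk_quotient_𝓘Λ (I : Set (Fin (n + 1))) {x : P n K}
    (hx : x ∈ (AffineCoordBlowup.𝓘Λ n K I).support) :
    IsRegularLocalRing ((P n K).presheaf.stalk x ⧸ stalkIdeal (AffineCoordBlowup.𝓘Λ n K I) x) :=
  isRegularLocalRing_stalk_quotient_stalkIdeal (AffineCoordBlowupLSB.isRegular_CΛ n K I) hx

/-- `(x_I)·𝒪_𝔓` contracts to `(x_I)` when `x_I ⊆ 𝔓` (a prime inside `𝔓`). -/
theorem comap_stalkIdeal_𝓘Λ (I : Set (Fin (n + 1))) {x : P n K}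
    (hx : x ∈ (AffineCoordBlowup.𝓘Λ n K I).support) :
    (stalkIdeal (AffineCoordBlowup.𝓘Λ n K I) x).comap
        (algebraMap (A n K) ((P n K).presheaf.stalk x)) = Ideal.span (X '' I) := by
  rw [stalkIdeal_𝓘Λ]
  refine IsLocalization.under_map_of_isPrime_disjoint x.asIdeal.primeCompl
    ((P n K).presheaf.stalk x) (Literature.RingTheory.MvPolynomial.isPrime_span_X_image I) ?_
  rw [Set.disjoint_left]
  intro a ha haI
  exact ha ((Ideal.span_le.mpr (by
    rintro _ ⟨i, hi, rfl⟩
    exact (mem_support_𝓘Λ_iff I x).mp hx i hi) : Ideal.span (X '' I) ≤ x.asIdeal) haI)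

/-- **`xᵢ ∉ (x_I)·𝒪_𝔓` for `i ∉ I`** (`x_I ⊆ 𝔓`). -/
theorem algebraMap_X_not_mem_stalkIdeal_𝓘Λ (I : Set (Fin (n + 1))) {x : P n K}
    (hx : x ∈ (AffineCoordBlowup.𝓘Λ n K I).support) {i : Fin (n + 1)} (hi : i ∉ I) :
    algebraMap (A n K) ((P n K).presheaf.stalk x) (X i) ∉ stalkIdeal (AffineCoordBlowup.𝓘Λ n K I) x := by
  intro h
  have h' : (X i : A n K) ∈ (stalkIdeal (AffineCoordBlowup.𝓘Λ n K I) x).comap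
      (algebraMap (A n K) ((P n K).presheaf.stalk x)) := Ideal.mem_comap.mpr h
  rw [comap_stalkIdeal_𝓘Λ I hx] at h'
  exact hi (Literature.RingTheory.MvPolynomial.X_mem_span_X_image_iff.mp h')

/-- **`xᵢ` is a non-zero-divisor of `𝒪_𝔓/(x_I)`** for `i ∉ I`, `x_I ⊆ 𝔓` (the quotient is a regular
local ring, hence a domain, and `xᵢ ≠ 0` there). -/
theorem mk_algebraMap_X_mem_nonZeroDivisors (I : Set (Fin (n + 1))) {x : P n K}
    (hx : x ∈ (AffineCoordBlowup.𝓘Λ n K I).support) {i : Fin (n + 1)} (hi : i ∉ I) :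
    Ideal.Quotient.mk (stalkIdeal (AffineCoordBlowup.𝓘Λ n K I) x)
        (algebraMap (A n K) ((P n K).presheaf.stalk x) (X i)) ∈
      nonZeroDivisors ((P n K).presheaf.stalk x ⧸ stalkIdeal (AffineCoordBlowup.𝓘Λ n K I) x) := by
  haveI := isRegularLocalRing_stalk_quotient_𝓘Λ I hx
  haveI := isDomain_of_isRegularLocalRing
    ((P n K).presheaf.stalk x ⧸ stalkIdeal (AffineCoordBlowup.𝓘Λ n K I) x)
  refine mem_nonZeroDivisors_of_ne_zero fun h => ?_
  exact algebraMap_X_not_mem_stalkIdeal_𝓘Λ I hx hi (Ideal.Quotient.eq_zero_iff_mem.mp h)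

/-- The stalk ideal of `V(x_I)` as a span of the germs of the `Xᵢ`. -/
theorem stalkIdeal_𝓘Λ_eq_span_image (I : Set (Fin (n + 1))) (x : P n K) :
    stalkIdeal (AffineCoordBlowup.𝓘Λ n K I) x =
      Ideal.span ((fun i => algebraMap (A n K) ((P n K).presheaf.stalk x) (X i)) '' I) := by
  rw [stalkIdeal_𝓘Λ, Ideal.map_span, Set.image_image]

/-! ## §3 Simple normal crossings -/

/-- **COORDINATE HYPERPLANES AND A COORDINATE CENTRE HAVE SIMPLE NORMAL CROSSINGS** (BGMW Def. 3.1.1 /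
Def. 3.1.3 (2), the tree's `HasSNCWith`): on `𝔸ⁿ⁺¹_K`, for every list `l` of coordinates and every set
`Λ` of coordinates, the hyperplanes `V(xᵢ)`, `i ∈ l`, have simple normal crossings and the coordinate
subspace `V(xᵢ : i ∈ Λ)` has simple normal crossings with them — at every scheme point `𝔓`, the germs
of the `xᵢ ∈ 𝔓` are part of one regular system of parameters of `𝒪_𝔓` adapted to all of them. -/
theorem hasSNCWith_coordHyperplanes_𝓘Λ (l : List (Fin (n + 1))) (Λ : Set (Fin (n + 1))) :
    HasSNCWith (l.map fun i => ofIdealTop (Ideal.span {coord n K i})) (AffineCoordBlowup.𝓘Λ n K Λ) := by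
  classical
  -- the index of a hyperplane sheaf
  let idx : (P n K).IdealSheafData → Fin (n + 1) := fun D =>
    if h : ∃ i, D = ofIdealTop (Ideal.span {coord n K i}) then h.choose else 0
  have hidx : ∀ i, idx (ofIdealTop (Ideal.span {coord n K i})) = i := by
    intro i
    have h : ∃ j, ofIdealTop (Ideal.span {coord n K i}) = ofIdealTop (Ideal.span {coord n K j}) :=
      ⟨i, rfl⟩
    simp only [idx, dif_pos h]
    exact (ofIdealTop_span_coord_injective h.choose_spec).symm
  have hmemE : ∀ D ∈ l.map fun i => ofIdealTop (Ideal.span {coord n K i}),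
      D = ofIdealTop (Ideal.span {coord n K (idx D)}) := by
    intro D hD
    obtain ⟨i, -, rfl⟩ := List.mem_map.mp hD
    rw [hidx]
  -- the local equations
  let f : ∀ x : P n K, (P n K).IdealSheafData → (P n K).presheaf.stalk x := fun x D =>
    algebraMap (A n K) ((P n K).presheaf.stalk x) (X (idx D))
  -- the span of the equations of a finite set `T` of hyperplanes is the stalk of `V(x_{idx T})`
  have hspanT : ∀ (x : P n K) (T : Finset (P n K).IdealSheafData),
      Ideal.span (f x '' (T : Set (P n K).IdealSheafData)) =
        stalkIdeal (AffineCoordBlowup.𝓘Λ n K (idx '' (T : Set (P n K).IdealSheafData))) x := by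
    intro x T
    rw [stalkIdeal_𝓘Λ_eq_span_image, Set.image_image]
  -- a hyperplane of `E` through `x` has `X (idx D) ∈ 𝔓`
  have hthrough : ∀ (x : P n K) (D : (P n K).IdealSheafData),
      D ∈ (l.map fun i => ofIdealTop (Ideal.span {coord n K i})) → x ∈ D.support →
        (X (idx D) : A n K) ∈ x.asIdeal := by
    intro x D hD hxD
    rw [hmemE D hD] at hxD
    rw [hmemE D hD, hidx]
    exact X_mem_asIdeal_of_mem_support hxD
  refine hasSNCWith_of_nonZeroDivisor_data _ _ f ?_ ?_ ?_
  · -- principal stalks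
    intro x D hD _
    change stalkIdeal D x = Ideal.span {algebraMap (A n K) ((P n K).presheaf.stalk x) (X (idx D))}
    conv_lhs => rw [hmemE D hD]
    rw [stalkIdeal_ofIdealTop_span_coord]
  · -- boundary alone
    intro x T hT
    have hxI : x ∈ (AffineCoordBlowup.𝓘Λ n K (idx '' (T : Set (P n K).IdealSheafData))).support := by
      rw [mem_support_𝓘Λ_iff]
      rintro _ ⟨D, hD, rfl⟩
      exact hthrough x D (hT D hD).1 (hT D hD).2
    refine ⟨?_, fun D hD hxD hDT => ?_⟩
    · rw [hspanT]
      exact isRegularLocalRing_stalk_quotient_𝓘Λ _ hxI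
    · have hi : idx D ∉ idx '' (T : Set (P n K).IdealSheafData) := by
        rintro ⟨D', hD', he⟩
        apply hDT
        have : D' = D := by rw [hmemE D' (hT D' hD').1, hmemE D hD, he]
        rw [← this]
        exact hD'
      exact mem_nonZeroDivisors_mk_of_eq (hspanT x T).symm
        (mk_algebraMap_X_mem_nonZeroDivisors _ hxI hi)
  · -- boundary and centre
    intro x hxC T hT
    have hxI : x ∈ (AffineCoordBlowup.𝓘Λ n K (Λ ∪ idx '' (T : Set (P n K).IdealSheafData))).support := by
      rw [mem_support_𝓘Λ_iff]
      rintro i (hi | ⟨D, hD, rfl⟩)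
      · exact (mem_support_𝓘Λ_iff Λ x).mp hxC i hi
      · exact hthrough x D (hT D hD).1 (hT D hD).2.1
    have hsup : stalkIdeal (AffineCoordBlowup.𝓘Λ n K Λ) x ⊔
        Ideal.span (f x '' (T : Set (P n K).IdealSheafData)) =
        stalkIdeal (AffineCoordBlowup.𝓘Λ n K (Λ ∪ idx '' (T : Set (P n K).IdealSheafData))) x := by
      rw [hspanT, stalkIdeal_𝓘Λ_eq_span_image, stalkIdeal_𝓘Λ_eq_span_image,
        stalkIdeal_𝓘Λ_eq_span_image, Set.image_union, Ideal.span_union]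
    refine ⟨?_, fun D hD hxD hDC hDT => ?_⟩
    · rw [hsup]
      exact isRegularLocalRing_stalk_quotient_𝓘Λ _ hxI
    · have hiΛ : idx D ∉ Λ := fun h => hDC (by
        rw [stalkIdeal_𝓘Λ_eq_span_image]
        exact Ideal.subset_span ⟨idx D, h, rfl⟩)
      have hi : idx D ∉ Λ ∪ idx '' (T : Set (P n K).IdealSheafData) := by
        rintro (h | ⟨D', hD', he⟩)
        · exact hiΛ h
        · apply hDT
          have : D' = D := by rw [hmemE D' (hT D' hD').1, hmemE D hD, he]
          rw [← this]
          exact hD'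
      exact mem_nonZeroDivisors_mk_of_eq hsup.symm (mk_algebraMap_X_mem_nonZeroDivisors _ hxI hi)

/-- **Coordinate hyperplanes have simple normal crossings** (`HasSNC`, no centre). -/
theorem hasSNC_coordHyperplanes (l : List (Fin (n + 1))) :
    HasSNC (l.map fun i => ofIdealTop (Ideal.span {coord n K i}) :
      List (P n K).IdealSheafData) :=
  (hasSNCWith_coordHyperplanes_𝓘Λ (K := K) l (∅ : Set (Fin (n + 1)))).hasSNC

end CoordinateSNC

end ChartDictionary

end Summit.ResolutionOfSingularities.ResolutionOfSingularities.Theorems.PIDim4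

end
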